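import Literature.Computability.AlgebraicComplexity.HamiltonianCycleVNP

/-!
# Route FifoMatching — `NNInVNP` (stmt-ValiantsHypothesis-11618): definitions and combinatorics

Objects of the `VNP`-membership proof for the nest-free (FIFO) matching family `NN` (main file
`FifoMatchingNNInVNP.lean`), after Bürgisser–Clausen–Shokrollahi 1997, proof of Prop. (21.15), in the
format of `Literature/Computability/AlgebraicComplexity/HamiltonianCycleVNP.lean`:

* arcs of `[N]`, the conflicting pairs `nnBadPairs` (shared endpoint or nesting), the good arc sets
  `goodArcSets` (oriented, pairwise non-conflicting, covering), the route's summation range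
  `nnMatchings` (nest-free fixed-point-free involutions) and the bijection `arcSet` between the two
  (`arcSet_mem_goodArcSets`, `arcSet_injOn`, `exists_arcSet_eq`);
* the recogniser value `nnRecogniserVal` (`α ω β` at a Boolean point), the witness
  `nnWitness = α ω β μ` in the variables `NNVars N = arcs ⊕ Fin (N·N)`, the polynomial `nnPoly N`
  (`NN` at `N = 2n`, the route's term) and the witness family `nnVNPFamily`.

Honest framing: bookkeeping towards the membership lemma `NN ∈ VNP`; nothing here bears on `VP ≠ VNP`.
-/

set_option linter.dupNamespace false -- single-conjunct summit: `ValiantsHypothesis.ValiantsHypothesis`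

noncomputable section

open MvPolynomial

universe u

namespace Summit.ValiantsHypothesis.ValiantsHypothesis.Theorems.FifoMatching

open Literature.Computability.AlgebraicComplexity

/-! ### Arcs, conflicts, good arc sets -/

section Arcs

variable {N : ℕ}

/-- The ordered pairs of distinct conflicting arcs of `[N]`: two arcs conflict if they share an
endpoint or if the first nests the second (`a.1 < b.1 < b.2 < a.2`). Index set of the factor `α` of
the `VNP` witness (BCS 1997, proof of Prop. (21.15), the rôle of the pairs "`i = ℓ` iff `j ≠ m`").
[cite: BurgisserClausenShokrollahi1997, Prop. (21.15)] -/
def nnBadPairs (N : ℕ) : Finset ((Fin N × Fin N) × (Fin N × Fin N)) :=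
  Finset.univ.filter fun pq => pq.1 ≠ pq.2 ∧
    (pq.1.1 = pq.2.1 ∨ pq.1.1 = pq.2.2 ∨ pq.1.2 = pq.2.1 ∨ pq.1.2 = pq.2.2 ∨
      (pq.1.1 < pq.2.1 ∧ pq.2.1 < pq.2.2 ∧ pq.2.2 < pq.1.2))

/-- There are at most `N⁴` conflicting pairs. [folklore] -/
theorem card_nnBadPairs_le (N : ℕ) : (nnBadPairs N).card ≤ N ^ 4 := by
  refine (Finset.card_filter_le _ _).trans ?_
  simp only [Finset.card_univ, Fintype.card_prod, Fintype.card_fin]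
  exact le_of_eq (by ring)

/-- Membership in `nnBadPairs`, unfolded. [folklore] -/
theorem mem_nnBadPairs {a b : Fin N × Fin N} :
    (a, b) ∈ nnBadPairs N ↔ a ≠ b ∧
      (a.1 = b.1 ∨ a.1 = b.2 ∨ a.2 = b.1 ∨ a.2 = b.2 ∨ (a.1 < b.1 ∧ b.1 < b.2 ∧ b.2 < a.2)) := by
  simp [nnBadPairs]

/-- The **good arc sets**: Boolean arc sets `E ⊆ [N] × [N]` all of whose arcs are oriented
(`i < j`), with no two distinct arcs in conflict, and covering every vertex — the Boolean points at
which the recogniser `α ω β` does not vanish. [cite: BurgisserClausenShokrollahi1997, Prop. (21.15)] -/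
def goodArcSets (N : ℕ) : Finset (Fin N × Fin N → Bool) :=
  Finset.univ.filter fun E =>
    (∀ a, E a = true → a.1 < a.2) ∧
    (∀ pq ∈ nnBadPairs N, ¬ (E pq.1 = true ∧ E pq.2 = true)) ∧
    (∀ v : Fin N, ∃ a, E a = true ∧ (a.1 = v ∨ a.2 = v))

/-- Membership in `goodArcSets`, unfolded. [folklore] -/
theorem mem_goodArcSets {E : Fin N × Fin N → Bool} :
    E ∈ goodArcSets N ↔
      (∀ a, E a = true → a.1 < a.2) ∧
      (∀ pq ∈ nnBadPairs N, ¬ (E pq.1 = true ∧ E pq.2 = true)) ∧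
      (∀ v : Fin N, ∃ a, E a = true ∧ (a.1 = v ∨ a.2 = v)) := by
  simp only [goodArcSets, Finset.mem_filter, Finset.mem_univ, true_and]

/-- In a good arc set, two arcs through a common vertex coincide. [folklore] -/
theorem eq_of_mem_goodArcSets {E : Fin N × Fin N → Bool} (hE : E ∈ goodArcSets N)
    {a b : Fin N × Fin N} (ha : E a = true) (hb : E b = true) {v : Fin N}
    (hav : a.1 = v ∨ a.2 = v) (hbv : b.1 = v ∨ b.2 = v) : a = b := by
  by_contra hne
  refine (mem_goodArcSets.1 hE).2.1 (a, b) ?_ ⟨ha, hb⟩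
  rw [mem_nnBadPairs]
  refine ⟨hne, ?_⟩
  rcases hav with h1 | h1 <;> rcases hbv with h2 | h2
  · exact Or.inl (h1.trans h2.symm)
  · exact Or.inr (Or.inl (h1.trans h2.symm))
  · exact Or.inr (Or.inr (Or.inl (h1.trans h2.symm)))
  · exact Or.inr (Or.inr (Or.inr (Or.inl (h1.trans h2.symm))))

/-! ### Nest-free matchings and their arc sets -/

/-- The route's summation range: maps `M : [N] → [N]` that are fixed-point-free involutions without
nested arcs (`i < j < M j < M i` excluded) — the nest-free perfect matchings of `[N]`. [folklore] -/
def nnMatchings (N : ℕ) : Finset (Fin N → Fin N) :=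
  Finset.univ.filter fun M =>
    (∀ i, M (M i) = i) ∧ (∀ i, M i ≠ i) ∧ ∀ i j, i < j → j < M j → M j < M i → False

/-- Membership in `nnMatchings`, unfolded. [folklore] -/
theorem mem_nnMatchings {M : Fin N → Fin N} :
    M ∈ nnMatchings N ↔
      (∀ i, M (M i) = i) ∧ (∀ i, M i ≠ i) ∧ ∀ i j, i < j → j < M j → M j < M i → False := by
  simp only [nnMatchings, Finset.mem_filter, Finset.mem_univ, true_and]

/-- The (oriented) arc set `{(i, M i) : i < M i}` of `M`, as a Boolean function on `[N] × [N]`.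
[folklore] -/
def arcSet (M : Fin N → Fin N) : Fin N × Fin N → Bool :=
  fun a => decide (a.1 < a.2 ∧ M a.1 = a.2)

/-- `arcSet M a = true ↔ a.1 < a.2 ∧ M a.1 = a.2`. [folklore] -/
theorem arcSet_eq_true_iff (M : Fin N → Fin N) (a : Fin N × Fin N) :
    arcSet M a = true ↔ a.1 < a.2 ∧ M a.1 = a.2 := by
  simp [arcSet]

/-- The arc set of a nest-free matching is a good arc set. [folklore] -/
theorem arcSet_mem_goodArcSets {M : Fin N → Fin N} (hM : M ∈ nnMatchings N) :
    arcSet M ∈ goodArcSets N := by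
  obtain ⟨hinv, hfix, hnest⟩ := mem_nnMatchings.1 hM
  refine mem_goodArcSets.2 ⟨fun a ha => ((arcSet_eq_true_iff M a).1 ha).1, ?_, ?_⟩
  · rintro ⟨a, b⟩ hab ⟨ha, hb⟩
    rw [mem_nnBadPairs] at hab
    obtain ⟨hne, hc⟩ := hab
    rw [arcSet_eq_true_iff] at ha hb
    obtain ⟨ha1, ha2⟩ := ha
    obtain ⟨hb1, hb2⟩ := hb
    rcases hc with h | h | h | h | h
    · exact hne (Prod.ext h (by rw [← ha2, ← hb2, h]))
    · -- `a.1 = b.2 = M b.1`, so `a.2 = M a.1 = b.1`, and both arcs are oriented: contradiction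
      have e1 : a.2 = b.1 := by rw [← ha2, h, ← hb2, hinv]
      have : a.1 < a.1 :=
        calc a.1 < a.2 := ha1
          _ = b.1 := e1
          _ < b.2 := hb1
          _ = a.1 := h.symm
      exact lt_irrefl _ this
    · have e1 : b.2 = a.1 := by rw [← hb2, ← h, ← ha2, hinv]
      have : b.1 < b.1 :=
        calc b.1 < b.2 := hb1
          _ = a.1 := e1
          _ < a.2 := ha1
          _ = b.1 := h
      exact lt_irrefl _ this
    · have e1 : a.1 = b.1 := by rw [← hinv a.1, ha2, h, ← hb2, hinv]
      exact hne (Prod.ext e1 h)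
    · obtain ⟨h1, h2, h3⟩ := h
      exact hnest a.1 b.1 h1 (by rw [hb2]; exact h2) (by rw [ha2, hb2]; exact h3)
  · intro v
    by_cases hv : v < M v
    · exact ⟨(v, M v), (arcSet_eq_true_iff M _).2 ⟨hv, rfl⟩, Or.inl rfl⟩
    · have hlt : M v < v := lt_of_le_of_ne (not_lt.1 hv) (hfix v)
      exact ⟨(M v, v), (arcSet_eq_true_iff M _).2 ⟨hlt, hinv v⟩, Or.inr rfl⟩

/-- A nest-free matching is determined by its arc set. [folklore] -/
theorem arcSet_injOn : Set.InjOn (arcSet (N := N)) ↑(nnMatchings N) := by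
  intro M hM M' hM' h
  rw [Finset.mem_coe, mem_nnMatchings] at hM hM'
  funext v
  by_cases hv : v < M v
  · have h1 : arcSet M (v, M v) = true := (arcSet_eq_true_iff M _).2 ⟨hv, rfl⟩
    rw [h, arcSet_eq_true_iff] at h1
    exact h1.2.symm
  · have hlt : M v < v := lt_of_le_of_ne (not_lt.1 hv) (hM.2.1 v)
    have h1 : arcSet M (M v, v) = true := (arcSet_eq_true_iff M _).2 ⟨hlt, hM.1 v⟩
    rw [h, arcSet_eq_true_iff] at h1
    -- `M' (M v) = v`, hence `M' v = M' (M' (M v)) = M v`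
    have h2 := congrArg M' h1.2
    rw [hM'.1] at h2
    exact h2

/-- Every good arc set is the arc set of a nest-free matching: `M v` is the other endpoint of the
unique arc through `v`. [folklore] -/
theorem exists_arcSet_eq {E : Fin N × Fin N → Bool} (hE : E ∈ goodArcSets N) :
    ∃ M ∈ nnMatchings N, arcSet M = E := by
  obtain ⟨hor, -, hcov⟩ := mem_goodArcSets.1 hE
  choose a ha hav using hcov
  -- `M v` := the endpoint of `a v` other than `v`
  let M : Fin N → Fin N := fun v => if (a v).1 = v then (a v).2 else (a v).1
  have hlt : ∀ v, (a v).1 < (a v).2 := fun v => hor _ (ha v)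
  -- the arc `a v` is `(v, M v)` or `(M v, v)`
  have hM : ∀ v, ((a v).1 = v ∧ (a v).2 = M v) ∨ ((a v).2 = v ∧ (a v).1 = M v) := by
    intro v
    by_cases h : (a v).1 = v
    · exact Or.inl ⟨h, by simp [M, h]⟩
    · exact Or.inr ⟨(hav v).resolve_left h, by simp [M, h]⟩
  have hMv : ∀ v, (a v).1 = M v ∨ (a v).2 = M v := fun v =>
    (hM v).elim (fun h => Or.inr h.2) (fun h => Or.inl h.2)
  -- uniqueness of the arc through a vertex
  have huniq : ∀ v b, E b = true → (b.1 = v ∨ b.2 = v) → b = a v := fun v b hb hbv =>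
    eq_of_mem_goodArcSets hE hb (ha v) hbv (hav v)
  -- the arc through `M v` is again `a v`
  have haM : ∀ v, a (M v) = a v := fun v => (huniq (M v) (a v) (ha v) (hMv v)).symm
  have hinv : ∀ v, M (M v) = v := by
    intro v
    rcases hM v with ⟨h1, h2⟩ | ⟨h1, h2⟩
    · -- `a v = (v, M v)`, so `M (M v)` is the endpoint of `a v` other than `M v`, i.e. `v`
      have hne : (a v).1 ≠ M v := by rw [← h2]; exact (hlt v).ne
      show (if (a (M v)).1 = M v then (a (M v)).2 else (a (M v)).1) = v
      rw [haM, if_neg hne, h1]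
    · show (if (a (M v)).1 = M v then (a (M v)).2 else (a (M v)).1) = v
      rw [haM, if_pos h2, h1]
  have hfix : ∀ v, M v ≠ v := by
    intro v h
    rcases hM v with ⟨h1, h2⟩ | ⟨h1, h2⟩
    · exact (hlt v).ne (by rw [h1, h2, h])
    · exact (hlt v).ne (by rw [h2, h1, h])
  -- an oriented pair `(v, M v)` with `v < M v` is the arc `a v` itself
  have harc : ∀ v, v < M v → a v = (v, M v) := by
    intro v hv
    rcases hM v with ⟨h1, h2⟩ | ⟨h1, h2⟩
    · exact Prod.ext h1 h2
    · exfalso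
      have := hlt v
      rw [h1, h2] at this
      exact lt_asymm hv this
  refine ⟨M, mem_nnMatchings.2 ⟨hinv, hfix, ?_⟩, ?_⟩
  · -- nest-freeness: nested arcs `(i, M i) ⊃ (j, M j)` would be a conflicting pair of `E`
    intro i j hij hj hji
    have hi : i < M i := hij.trans (hj.trans hji)
    have hmem : (a i, a j) ∈ nnBadPairs N := by
      rw [mem_nnBadPairs, harc i hi, harc j hj]
      refine ⟨fun h => ?_, Or.inr (Or.inr (Or.inr (Or.inr ⟨hij, hj, hji⟩)))⟩
      exact (ne_of_lt hij) (Prod.ext_iff.1 h).1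
    exact (mem_goodArcSets.1 hE).2.1 _ hmem ⟨ha i, ha j⟩
  · funext b
    rw [Bool.eq_iff_iff, arcSet_eq_true_iff]
    constructor
    · rintro ⟨hb1, hb2⟩
      have h := harc b.1 (hb2 ▸ hb1)
      rw [hb2] at h
      rw [show b = a b.1 from (Prod.ext rfl rfl : b = (b.1, b.2)).trans h.symm]
      exact ha b.1
    · intro hb
      have h := huniq b.1 b hb (Or.inl rfl)
      rcases hM b.1 with ⟨h1, h2⟩ | ⟨h1, h2⟩
      · refine ⟨hor b hb, ?_⟩
        rw [← h] at h2
        exact h2.symm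
      · exfalso
        have := hlt b.1
        rw [← h] at this h1
        -- `h1 : b.2 = b.1` contradicts `b.1 < b.2`
        exact (hor b hb).ne' h1

end Arcs

/-! ### The recogniser value and the witness polynomials -/

section WitnessDefs

variable {N : ℕ} {R : Type*} [CommRing R]

/-- The value of the recogniser `α · ω · β` of the `VNP` witness at a Boolean arc set `E`
(`[b] = 1` if `b` else `0`): `∏_{(a,b) conflicting} (1 - [E a][E b]) · ∏_{a : ¬ a.1 < a.2} (1 - [E a]) ·
∏_v ∑_{a ∋ v} [E a]`. [cite: BurgisserClausenShokrollahi1997, Prop. (21.15)] -/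
def nnRecogniserVal (E : Fin N × Fin N → Bool) : R :=
  (∏ pq ∈ nnBadPairs N, (1 - (if E pq.1 then (1 : R) else 0) * (if E pq.2 then (1 : R) else 0))) *
    (∏ a ∈ Finset.univ.filter (fun a : Fin N × Fin N => ¬ a.1 < a.2), (1 - (if E a then (1 : R) else 0))) *
    ∏ v : Fin N, ∑ a ∈ Finset.univ.filter (fun a : Fin N × Fin N => a.1 = v ∨ a.2 = v),
      (if E a then (1 : R) else 0)

end WitnessDefs

/-! ### The `VNP` witness for `NN_N` -/

section WitnessPolys

variable (N : ℕ) (k : Type u) [CommRing k]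

/-- The variables of the witness for `NN_N`: the `N²` arc variables `X_a` (`Sum.inl a`) and `N²`
Boolean arc variables `Y_a = X (Sum.inr (finProdFinEquiv a))`, enumerated by `Fin (N·N)` as
`IsVNPFamily` requires. [cite: BurgisserClausenShokrollahi1997, Prop. (21.15)] -/
abbrev NNVars : Type :=
  (Fin N × Fin N) ⊕ Fin (N * N)

/-- `α = ∏_{(a,b) conflicting} (1 - Y_a Y_b)`. [cite: BurgisserClausenShokrollahi1997, Prop. (21.15)] -/
def nnAlpha : MvPolynomial (NNVars N) k :=
  ∏ pq ∈ nnBadPairs N,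
    (1 - X (Sum.inr (finProdFinEquiv pq.1)) * X (Sum.inr (finProdFinEquiv pq.2)))

/-- `ω = ∏_{a : ¬ a.1 < a.2} (1 - Y_a)`. [cite: BurgisserClausenShokrollahi1997, Prop. (21.15)] -/
def nnOmega : MvPolynomial (NNVars N) k :=
  ∏ a ∈ Finset.univ.filter (fun a : Fin N × Fin N => ¬ a.1 < a.2),
    (1 - X (Sum.inr (finProdFinEquiv a)))

/-- `β = ∏_v ∑_{a ∋ v} Y_a`. [cite: BurgisserClausenShokrollahi1997, Prop. (21.15)] -/
def nnBeta : MvPolynomial (NNVars N) k :=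
  ∏ v : Fin N, ∑ a ∈ Finset.univ.filter (fun a : Fin N × Fin N => a.1 = v ∨ a.2 = v),
    X (Sum.inr (finProdFinEquiv a))

/-- The cover product `μ = ∏_a (1 - Y_a + Y_a X_a)` (at a Boolean point: the monomial of the chosen
arcs). [cite: BurgisserClausenShokrollahi1997, Prop. (21.15)] -/
def nnCover : MvPolynomial (NNVars N) k :=
  ∏ a : Fin N × Fin N,
    (1 - X (Sum.inr (finProdFinEquiv a)) + X (Sum.inr (finProdFinEquiv a)) * X (Sum.inl a))

/-- The `VNP` witness `G_N(X, Y) = α(Y) ω(Y) β(Y) μ(X, Y)` for `NN_N`. [cite: BurgisserClausenShokrollahi1997, Prop. (21.15)] -/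
def nnWitness : MvPolynomial (NNVars N) k :=
  nnAlpha N k * nnOmega N k * nnBeta N k * nnCover N k

/-- `NN_N(X) = ∑_M [M a nest-free fixed-point-free involution of [N]] ∏_{i < M i} X_{(i, M i)}`, the
route's polynomial at `N = 2n` (same term, with `N` for `2 * n`). [folklore] -/
def nnPoly : MvPolynomial (Fin N × Fin N) k :=
  ∑ M : Fin N → Fin N,
    if ((∀ i, M (M i) = i) ∧ (∀ i, M i ≠ i) ∧ ∀ i j, i < j → j < M j → M j < M i → False) then
      ∏ i : Fin N, (if i < M i then X (i, M i) else 1) else 0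

/-- The `VNP` witness family for `NN`: `G_{2n}`. [cite: BurgisserClausenShokrollahi1997, Prop. (21.15)] -/
def nnVNPFamily (n : ℕ) : MvPolynomial ((Fin (2 * n) × Fin (2 * n)) ⊕ Fin (2 * n * (2 * n))) k :=
  nnWitness (2 * n) k

end WitnessPolys

end Summit.ValiantsHypothesis.ValiantsHypothesis.Theorems.FifoMatching

end
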